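import Summits.QuantumFields.YangMills.Theorems.ConvexGribovBodyBrascampLiebVacuumSCStubFloorReduction

/-!
# Stub `stub_floorAssembly` of the line `SketchIdeator1` for the crux `BrascampLiebVacuumSC`
# (stmt-QuantumFields-16404, route `ConvexGribovBody`)

Measure-theoretic assembly, at FIXED `(β, S)`, of the volume-uniform floor of the Coulomb
covariance scale. On the torus `(2S+1)⁴`, for a compact group `G` with a faithful continuous unitary
representation `r`, write (time-zero slice, `L = 2S+1`, `μ = wilson4 r β S`, `U^h` the gauge
transform, `A^h_j(y) = ½(ρ(U^h_ℓ) − ρ(U^h_ℓ)ᴴ)` the gauge-fixed link field `gluon`)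

* `P(U) = Σ_y Σ_{j<k} (N − Re tr ρ(U_p))` — the slice plaquette energy,
* `Hd(U,h) = Σ_y Σ_j ‖1 − ½(ρ(U^h_ℓ) + ρ(U^h_ℓ)ᴴ)‖²_F` — the quartic link deviation,
* `Am(U,h) = Σ_j Σ_y ‖A^h_j(y)‖²_F`.

**Claim (`stub_floorAssembly`).** If `a ≤ E_μ[N − Re tr ρ(U_p)]` for every slice plaquette (h1),
`E_μ[inf_{h ∈ argmin coul(U,·)} Hd] ≤ (1/16) E_μ[P]` (h2) and `P/8 − Hd(U,h) ≤ Am(U,h)` in every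
gauge `h` (h3), then `3a/16 ≤ E_μ[sup_{h ∈ argmin} L⁻³ Am]`.

**Proof.** Pointwise in `U`: for every minimiser `h`, `Am(U,h) ≤ L³ · sup` (`le_ciSup`; the range
is bounded, `Am ≤ 3NL³` by unitarity), so by h3 `P/8 − L³ sup ≤ Hd(U,h)`, whence
`P/8 − L³ sup ≤ inf Hd` (`le_ciInf`; minimisers exist). Integrate (`integral_mono`): the `sup`/`inf`
over the closed argmin graph of the jointly continuous bounded `Am`, `Hd` are Borel by the Berge
lemma `SupMeasurable.measurable_iSup_subtype_of_isClosed` (for the `inf`, `inf f = −sup (−f)` in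
`ℝ`) and bounded, `P` is continuous on a compact space; then use h2 and
`E_μ[P] = Σ_y Σ_{j<k} E_μ[N − Re tr ρ(U_p)] ≥ 3 L³ a` (three pairs `j < k` in `Fin 3`, `L³` sites,
h1): `E_μ[sup L⁻³ Am] ≥ (E_μ[P]/8 − E_μ[P]/16)/L³ ≥ 3a/16`.

The measure theory is done once over an abstract compact `X × Y` with a closed graph `K`
(`FloorAssembly.floor_assembly_abstract`); the stub instantiates it with `X = GaugeConfig`,
`Y = Site → G`, `K = IsCoulMin r S` (`G` is second countable through `ρ`, so the product σ-algebra
on `GaugeConfig` is Borel-compatible). Helper lemmas live in the sub-namespace `FloorAssembly`.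
No named facts are used.
-/

set_option autoImplicit false

open scoped BigOperators Topology Matrix
open Filter MeasureTheory ProbabilityTheory
open Literature.MathematicalPhysics.QuantumFieldTheory
open Summit.QuantumFields.YangMills.Cruxes.CovarianceBound.SupportWindow
  (froSq coulombF IsCoulMin gluon modeCov supCov wilson4)

noncomputable section

namespace Summit.QuantumFields.YangMills.Theorems.BrascampLiebVacuumSC

namespace FloorAssembly

open Summit.QuantumFields.YangMills.Cruxes.CovarianceBound.SupportWindow.SupMeasurable

/-! ### Abstract measure theory: `sup` / `inf` over a closed graph with nonempty fibres -/

/-- In `ℝ`, `inf f = −sup (−f)` with no hypotheses (Mathlib's `Real.sInf_def`). [folklore] -/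
theorem iInf_eq_neg_iSup_neg {ι : Sort*} (f : ι → ℝ) : ⨅ i, f i = -⨆ i, -f i := by
  rw [iInf, Real.sInf_def, Set.neg_range]
  rfl

variable {X Y : Type*} [TopologicalSpace X] [CompactSpace X] [MeasurableSpace X]
  [OpensMeasurableSpace X] [TopologicalSpace Y] [CompactSpace Y]

omit [CompactSpace X] in
/-- Berge + boundedness: for a closed `K ⊆ X × Y` with nonempty fibres (`Y` compact) and a jointly
continuous `f` with `0 ≤ f ≤ B`, the fibrewise supremum `x ↦ sup_{y ∈ K_x} f(x,y)` is integrable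
for every finite measure (Borel by `SupMeasurable.measurable_iSup_subtype_of_isClosed`, values in
`[0, max B 0]`). [folklore] -/
theorem integrable_iSup_subtype (μ : Measure X) [IsFiniteMeasure μ] {K : X → Y → Prop}
    (hK : IsClosed {q : X × Y | K q.1 q.2}) (hne : ∀ x, ∃ y, K x y) {f : X → Y → ℝ}
    (hf : Continuous fun q : X × Y => f q.1 q.2) (h0 : ∀ x y, 0 ≤ f x y) {B : ℝ}
    (hB : ∀ x y, f x y ≤ B) :
    Integrable (fun x => ⨆ y : {y // K x y}, f x y.1) μ :=
  Integrable.of_mem_Icc 0 (max B 0)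
    (measurable_iSup_subtype_of_isClosed hK hne hf hB).aemeasurable
    (ae_of_all _ fun x => ⟨Real.iSup_nonneg fun y => h0 x y.1,
      Real.iSup_le (fun y => (hB x y.1).trans (le_max_left _ _)) (le_max_right _ _)⟩)

/-- The same for the fibrewise infimum of a jointly continuous `f ≥ 0` (`X` compact as well):
`x ↦ inf_{y ∈ K_x} f(x,y)` is Borel (`inf f = −sup (−f)`, Berge applied to `−f ≤ 0`) with values
in `[0, max f]`, hence integrable for every finite measure. [folklore] -/
theorem integrable_iInf_subtype (μ : Measure X) [IsFiniteMeasure μ] {K : X → Y → Prop}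
    (hK : IsClosed {q : X × Y | K q.1 q.2}) (hne : ∀ x, ∃ y, K x y) {f : X → Y → ℝ}
    (hf : Continuous fun q : X × Y => f q.1 q.2) (h0 : ∀ x y, 0 ≤ f x y) :
    Integrable (fun x => ⨅ y : {y // K x y}, f x y.1) μ := by
  obtain ⟨B, hB⟩ := (isCompact_range hf).bddAbove
  have hB' : ∀ x y, f x y ≤ B := fun x y => hB (Set.mem_range_self ((x, y) : X × Y))
  have hmeas : Measurable fun x => ⨅ y : {y // K x y}, f x y.1 := by
    have h : (fun x => ⨅ y : {y // K x y}, f x y.1) =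
        fun x => -⨆ y : {y // K x y}, -f x y.1 := funext fun x => iInf_eq_neg_iSup_neg _
    rw [h]
    exact (measurable_iSup_subtype_of_isClosed (f := fun x y => -f x y) hK hne hf.fun_neg
      (fun x y => neg_nonpos.2 (h0 x y))).neg
  refine Integrable.of_mem_Icc 0 B hmeas.aemeasurable (ae_of_all _ fun x => ⟨?_, ?_⟩)
  · exact Real.iInf_nonneg fun y => h0 x y.1
  · obtain ⟨y₀, hy₀⟩ := hne x
    exact (ciInf_le (f := fun y : {y // K x y} => f x y.1)
      ⟨0, by
        rintro _ ⟨y, rfl⟩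
        exact h0 x y.1⟩ ⟨y₀, hy₀⟩).trans (hB' x y₀)

/-- **Abstract floor assembly.** Let `X`, `Y` be compact, `μ` a finite measure on `X`,
`K ⊆ X × Y` closed with nonempty fibres, `P : X → ℝ` continuous, `Hd, Am : X × Y → ℝ` jointly
continuous and nonnegative with `Am ≤ B`, and `L > 0`. If `P/8 − Hd ≤ Am` pointwise (h3),
`∫ inf_{K_x} Hd dμ ≤ (1/16) ∫ P dμ` (h2) and `3 a L ≤ ∫ P dμ`, then
`3a/16 ≤ ∫ sup_{K_x} Am/L dμ`. Pointwise `(P/8 − inf Hd)/L ≤ sup Am/L` on the nonempty fibre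
(`le_ciSup`, `le_ciInf`), then `integral_mono` (integrability from the two lemmas above and
continuity of `P`) and arithmetic. [folklore] -/
theorem floor_assembly_abstract (μ : Measure X) [IsFiniteMeasure μ] (L a : ℝ)
    {K : X → Y → Prop} {P : X → ℝ} {Hd Am : X → Y → ℝ}
    (h3 : ∀ x y, (1 / 8 : ℝ) * P x - Hd x y ≤ Am x y)
    (h2 : ∫ x, (⨅ y : {y // K x y}, Hd x y.1) ∂μ ≤ (1 / 16 : ℝ) * ∫ x, P x ∂μ)
    (hK : IsClosed {q : X × Y | K q.1 q.2}) (hne : ∀ x, ∃ y, K x y)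
    (hPc : Continuous P) (hHc : Continuous fun q : X × Y => Hd q.1 q.2)
    (hAc : Continuous fun q : X × Y => Am q.1 q.2)
    (hH0 : ∀ x y, 0 ≤ Hd x y) (hA0 : ∀ x y, 0 ≤ Am x y) (B : ℝ) (hAB : ∀ x y, Am x y ≤ B)
    (hL : 0 < L) (hP : 3 * a * L ≤ ∫ x, P x ∂μ) :
    3 * a / 16 ≤ ∫ x, (⨆ y : {y // K x y}, Am x y.1 / L) ∂μ := by
  -- Step 1: the pointwise inequality on the nonempty fibre.
  have hpt : ∀ x, (P x / 8 - ⨅ y : {y // K x y}, Hd x y.1) / L ≤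
      ⨆ y : {y // K x y}, Am x y.1 / L := by
    intro x
    obtain ⟨y₀, hy₀⟩ := hne x
    haveI : Nonempty {y // K x y} := ⟨⟨y₀, hy₀⟩⟩
    have hbdd : BddAbove (Set.range fun y : {y // K x y} => Am x y.1 / L) :=
      ⟨B / L, by
        rintro _ ⟨y, rfl⟩
        exact div_le_div_of_nonneg_right (hAB x y.1) hL.le⟩
    have hkey : ∀ y : {y // K x y},
        P x / 8 - L * (⨆ y' : {y // K x y}, Am x y'.1 / L) ≤ Hd x y.1 := by
      intro y
      have hle : Am x y.1 / L ≤ ⨆ y' : {y // K x y}, Am x y'.1 / L := le_ciSup hbdd y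
      rw [div_le_iff₀' hL] at hle
      have h3' := h3 x y.1
      linarith
    have hinf : P x / 8 - L * (⨆ y' : {y // K x y}, Am x y'.1 / L) ≤
        ⨅ y : {y // K x y}, Hd x y.1 := le_ciInf hkey
    rw [div_le_iff₀' hL]
    linarith
  -- Step 2: integrate.
  have hintF : Integrable (fun x => ⨆ y : {y // K x y}, Am x y.1 / L) μ :=
    integrable_iSup_subtype μ hK hne (f := fun x y => Am x y / L) (hAc.div_const _)
      (fun x y => div_nonneg (hA0 x y) hL.le)
      (fun x y => div_le_div_of_nonneg_right (hAB x y) hL.le)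
  have hintI : Integrable (fun x => ⨅ y : {y // K x y}, Hd x y.1) μ :=
    integrable_iInf_subtype μ hK hne hHc hH0
  have hintP : Integrable P μ :=
    hPc.integrable_of_hasCompactSupport (HasCompactSupport.of_compactSpace _)
  have hmono : ∫ x, (P x / 8 - ⨅ y : {y // K x y}, Hd x y.1) / L ∂μ ≤
      ∫ x, (⨆ y : {y // K x y}, Am x y.1 / L) ∂μ :=
    integral_mono (((hintP.div_const 8).sub hintI).div_const _) hintF hpt
  rw [integral_div, integral_sub (hintP.div_const 8) hintI, integral_div] at hmono
  -- Step 3: arithmetic.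
  calc 3 * a / 16
      = (3 * a * L / 16) / L := by
        rw [eq_div_iff hL.ne']
        ring
    _ ≤ ((∫ x, P x ∂μ) / 16) / L := div_le_div_of_nonneg_right (by linarith) hL.le
    _ ≤ ((∫ x, P x ∂μ) / 8 - ∫ x, (⨅ y : {y // K x y}, Hd x y.1) ∂μ) / L :=
        div_le_div_of_nonneg_right (by linarith) hL.le
    _ ≤ ∫ x, (⨆ y : {y // K x y}, Am x y.1 / L) ∂μ := hmono

/-! ### Counting the slice plaquettes -/

/-- `Σ_y Σ_j Σ_k [j < k] a = 3 a (2S+1)³`: three pairs `j < k` in `Fin 3`, `(2S+1)³` sites.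
[folklore] -/
theorem sum_ite_lt_const (S : ℕ) (a : ℝ) :
    (∑ _y : Fin 3 → ZMod (2 * S + 1), ∑ j : Fin 3, ∑ k : Fin 3, if j < k then a else 0) =
      3 * a * (2 * S + 1 : ℝ) ^ 3 := by
  have h3 : (∑ j : Fin 3, ∑ k : Fin 3, if j < k then a else 0) = 3 * a := by
    simp only [Fin.sum_univ_three, Fin.isValue, Fin.reduceLT, if_true, if_false]
    ring
  rw [Finset.sum_const, Finset.card_univ, nsmul_eq_mul, card_slice, h3]
  ring

end FloorAssembly

/-! ### The stub -/

open FloorAssembly in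
open Summit.QuantumFields.YangMills.Cruxes.CovarianceBound.SupportWindow.SupMeasurable in
/-- **Stub `stub_floorAssembly` (MEASURE THEORY — floor assembly)** of the line `SketchIdeator1`
for the crux `BrascampLiebVacuumSC`. At fixed `(β, S)`: a plaquette floor `a` (h1), the leak
inequality `E_μ[inf_{argmin} Hd] ≤ (1/16) E_μ[P]` (h2) and the any-gauge algebra
`P/8 − Hd(U,h) ≤ Am(U,h)` (h3) give `3a/16 ≤ ∫ sup_{h ∈ argmin} L⁻³ Σ_{j,y} ‖A^h_j(y)‖²_F dμ`.
Proof: `FloorAssembly.floor_assembly_abstract` with `X = GaugeConfig`, `Y = Site → G`,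
`K = IsCoulMin r S` (closed graph, nonempty fibres: `SupMeasurable.isClosed_isCoulMin`,
`exists_isCoulMin`), `B = 3N(2S+1)³` (`froSq_gluon_le`), `G` second countable through `ρ`; the
slice functionals are finite sums of continuous functions of `(U, h)`, and
`∫ P dμ = Σ_y Σ_{j<k} ∫ (N − Re tr ρ(U_p)) dμ ≥ 3 (2S+1)³ a` by h1 (`integral_finsetSum`,
`FloorAssembly.sum_ite_lt_const`). [folklore] -/
theorem stub_floorAssembly :
    ∀ (G : Type) [Group G] [TopologicalSpace G] [IsTopologicalGroup G] [CompactSpace G]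
    [MeasurableSpace G] [BorelSpace G] (r : LatticeRep G) (β a : ℝ) (S : ℕ),
    (∀ (y : Fin 3 → ZMod (2 * S + 1)) (j k : Fin 3), j < k →
      a ≤ ∫ U, ((r.N : ℝ) - (r.ρ (plaquetteHolonomy U (Fin.cons (0 : ZMod (2 * S + 1)) y)
        j.succ k.succ)).trace.re) ∂(wilson4 r β S)) →
    (∫ U, (⨅ h : {h : Site 4 (2 * S + 1) → G // IsCoulMin r S U h},
        ∑ y : Fin 3 → ZMod (2 * S + 1), ∑ j : Fin 3,
          froSq (1 - (1 / 2 : ℂ) • (r.ρ (gaugeTransform h.1 U (Fin.cons (0 : ZMod (2 * S + 1)) y, j.succ)) +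
            (r.ρ (gaugeTransform h.1 U (Fin.cons (0 : ZMod (2 * S + 1)) y, j.succ)))ᴴ)))
        ∂(wilson4 r β S) ≤
      (1 / 16 : ℝ) * ∫ U, (∑ y : Fin 3 → ZMod (2 * S + 1), ∑ j : Fin 3, ∑ k : Fin 3,
        if j < k then ((r.N : ℝ) - (r.ρ (plaquetteHolonomy U (Fin.cons (0 : ZMod (2 * S + 1)) y)
          j.succ k.succ)).trace.re) else 0) ∂(wilson4 r β S)) →
    (∀ (U : GaugeConfig 4 (2 * S + 1) G) (h : Site 4 (2 * S + 1) → G),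
      (1 / 8 : ℝ) * (∑ y : Fin 3 → ZMod (2 * S + 1), ∑ j : Fin 3, ∑ k : Fin 3,
          if j < k then ((r.N : ℝ) - (r.ρ (plaquetteHolonomy U (Fin.cons (0 : ZMod (2 * S + 1)) y)
            j.succ k.succ)).trace.re) else 0) -
        (∑ y : Fin 3 → ZMod (2 * S + 1), ∑ j : Fin 3,
          froSq (1 - (1 / 2 : ℂ) • (r.ρ (gaugeTransform h U (Fin.cons (0 : ZMod (2 * S + 1)) y, j.succ)) +
            (r.ρ (gaugeTransform h U (Fin.cons (0 : ZMod (2 * S + 1)) y, j.succ)))ᴴ))) ≤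
      ∑ j : Fin 3, ∑ y : Fin 3 → ZMod (2 * S + 1), froSq (gluon r S U h y j)) →
    3 * a / 16 ≤ ∫ U, (⨆ h : {h : Site 4 (2 * S + 1) → G // IsCoulMin r S U h},
        (∑ j : Fin 3, ∑ y : Fin 3 → ZMod (2 * S + 1), froSq (gluon r S U h.1 y j)) /
          ((2 * S + 1 : ℝ) ^ 3)) ∂(wilson4 r β S) := by
  intro G _ _ _ _ _ _ r β a S h1 h2 h3
  haveI : SecondCountableTopology G :=
    (r.continuous.isClosedEmbedding r.injective).isEmbedding.secondCountableTopology
  -- the slice plaquette summands are continuous in `U`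
  have hT : ∀ (y : Fin 3 → ZMod (2 * S + 1)) (j k : Fin 3),
      Continuous fun U : GaugeConfig 4 (2 * S + 1) G => if j < k then
        ((r.N : ℝ) - (r.ρ (plaquetteHolonomy U (Fin.cons (0 : ZMod (2 * S + 1)) y)
          j.succ k.succ)).trace.re) else 0 := by
    intro y j k
    by_cases hjk : j < k
    · simp only [if_pos hjk]
      refine continuous_const.fun_sub
        (Complex.continuous_re.comp (r.continuous.comp ?_).matrix_trace)
      unfold plaquetteHolonomy
      fun_prop
    · simp only [if_neg hjk]
      exact continuous_const
  refine floor_assembly_abstract (wilson4 r β S) ((2 * S + 1 : ℝ) ^ 3) a h3 h2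
    (isClosed_isCoulMin r S) (exists_isCoulMin r S) ?_ ?_ ?_ ?_ ?_
    (3 * r.N * (2 * S + 1 : ℝ) ^ 3) ?_ (by positivity) ?_
  · -- `P` is continuous
    exact continuous_finsetSum _ fun y _ => continuous_finsetSum _ fun j _ =>
      continuous_finsetSum _ fun k _ => hT y j k
  · -- `Hd` is jointly continuous
    exact continuous_finsetSum _ fun y _ => continuous_finsetSum _ fun j _ =>
      continuous_froSq.comp (continuous_const.fun_sub
        (((continuous_rho_gaugeTransform r S _).fun_add
          (continuous_rho_gaugeTransform r S _).matrix_conjTranspose).fun_const_smul (1 / 2 : ℂ)))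
  · -- `Am` is jointly continuous
    exact continuous_finsetSum _ fun j _ => continuous_finsetSum _ fun y _ =>
      continuous_froSq.comp (continuous_gluon r S y j)
  · -- `0 ≤ Hd`
    exact fun U h => Finset.sum_nonneg fun _ _ => Finset.sum_nonneg fun _ _ => froSq_nonneg _
  · -- `0 ≤ Am`
    exact fun U h => Finset.sum_nonneg fun _ _ => Finset.sum_nonneg fun _ _ => froSq_nonneg _
  · -- `Am ≤ 3 N (2S+1)³` (unitarity)
    intro U h
    calc ∑ j : Fin 3, ∑ y : Fin 3 → ZMod (2 * S + 1), froSq (gluon r S U h y j)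
        ≤ ∑ _j : Fin 3, ∑ _y : Fin 3 → ZMod (2 * S + 1), (r.N : ℝ) :=
          Finset.sum_le_sum fun j _ => Finset.sum_le_sum fun y _ => froSq_gluon_le r S U h y j
      _ = 3 * r.N * (2 * S + 1 : ℝ) ^ 3 := by
          simp only [Finset.sum_const, Finset.card_univ, Fintype.card_fin, nsmul_eq_mul,
            card_slice, Nat.cast_ofNat]
          ring
  · -- `3 a (2S+1)³ ≤ ∫ P dμ`: a finite sum of `3 (2S+1)³` plaquette expectations, each `≥ a`
    have hI : ∀ (y : Fin 3 → ZMod (2 * S + 1)) (j k : Fin 3),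
        Integrable (fun U : GaugeConfig 4 (2 * S + 1) G => if j < k then
          ((r.N : ℝ) - (r.ρ (plaquetteHolonomy U (Fin.cons (0 : ZMod (2 * S + 1)) y)
            j.succ k.succ)).trace.re) else 0) (wilson4 r β S) := fun y j k =>
      (hT y j k).integrable_of_hasCompactSupport (HasCompactSupport.of_compactSpace _)
    rw [← sum_ite_lt_const S a, integral_finsetSum _ fun y _ =>
      integrable_finsetSum _ fun j _ => integrable_finsetSum _ fun k _ => hI y j k]
    refine Finset.sum_le_sum fun y _ => ?_
    rw [integral_finsetSum _ fun j _ => integrable_finsetSum _ fun k _ => hI y j k]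
    refine Finset.sum_le_sum fun j _ => ?_
    rw [integral_finsetSum _ fun k _ => hI y j k]
    refine Finset.sum_le_sum fun k _ => ?_
    by_cases hjk : j < k
    · simp only [if_pos hjk]
      exact h1 y j k hjk
    · simp only [if_neg hjk, integral_zero, le_refl]

end Summit.QuantumFields.YangMills.Theorems.BrascampLiebVacuumSC

end
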